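import Literature.NumberTheory.DiophantineGeometry.HyperellipticCoordinateRingDivisibility
import Literature.NumberTheory.DiophantineGeometry.GenEllDeCriticalValuesFamily
import Mathlib.FieldTheory.Separable
import HarnessLib

/-!
# [GenEll] Thm. 2.1 on the `D_e` route, family `t_c`: the ramification function divides the product of
# the fibre functions over the critical values (`N_c ∣ ∏_β (s + c·r^{k+2} − β·rs)`)

S. Mochizuki, *Arithmetic elliptic curves in general position*, Math. J. Okayama Univ. **52** (2010),
proof of Thm. 2.1 pp. 12–13 (the divisor of `dt` versus the fibres of `t` over its critical values)
[cite: MochizukiGenEll2010, Thm 2.1 proof p.12]; support file for the route item `GenEllTwo`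
(stmt-ABC-19679) of the abc-iut cell, W5 «R-b with defects» (STATUS findings F2/F3 2026-08-26: the
bad-place bound on `ord_w N_c` must come from an IDENTITY valid at every point, not from separation).

On the affine curve `D_e : s² = 1 − 4r^e`, `e = 2k + 1`, over a field `K` of characteristic zero, with the
family member `t_c = (s + c·r^{k+2})/(r·s)` (`c ≠ 0`) and its ramification function
`N_c = −s³ + c·((k+1)r^{k+2} − 2r^{3k+3})` (`= r²s³·dt_c/dr`; `DeCrit.NvalC` of abc-iut-w5-d059), let
`A ⊂ K` be a finite set containing the critical values `t_c(Q_θ)` (`DeCrit.tCritC k c θ`, `θ` the roots of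
`R_c = c²α² − β³`, `DeCrit.RpolyC`), all of which are assumed `K`-rational (`R_c` splits in `K`).  Then:

* `DeC.two_mul_N_eq` — in the coordinate ring `K[D_e] = K[r][s]/(s² − 1 + 4r^e)` with its tangent
  derivation `D` (`D r = 2s`, `D s = −4e·r^{2k}`): `2·N_c = U·D T − T·D U` for `T = s + c·r^{k+2}`,
  `U = r·s` (kernel check that `N_c/(rs)²` is `½·D t_c`);
* `DeC.maximal_of_N_mem` — every closed point of `D_e` at which `N_c` vanishes is a regular point of
  `t_c` (`rs ≠ 0` there) whose value is one of the `β ∈ A`;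
* `DeC.N_dvd_prod` — **`N_c ∣ ∏_{β∈A} (T − β·U)` in `K[D_e]`** (Mason's order drop at every zero of
  `N_c`, `HyperellipticCoordinateRing.dvd_prod_of_tangentDerivation`);
* `DeC.exists_prod_fibre_eq_N_mul` — the same as an IDENTITY AT EVERY POINT: there are
  `H₀, H₁ ∈ K[X]` such that for every commutative `K`-algebra `L` and all `r, s ∈ L` with
  `s² = 1 − 4r^{2k+1}`:  `∏_{β∈A} (s + c·r^{k+2} − β·rs) = N_c(r, s)·(H₀(r) + H₁(r)·s)`.

Theorems only: the curve polynomial enters as a variable `F` with defining hypothesis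
`hF : F = 1 - 4 * X ^ (2 * k + 1)`, the elements of `K[D_e] = CoordRing F` through defining hypotheses
`hx, hy, hc', hT, hU, hN`; the consumer-facing statement `DeC.exists_prod_fibre_eq_N_mul` is free of all of
them.  Classical; nothing here bears on [IUTchIII] Cor. 3.12.
-/

noncomputable section

open Polynomial
open scoped Polynomial.Bivariate

namespace Literature.NumberTheory.DiophantineGeometry.GenEll

open HyperellipticCoordinateRing

universe u v

section CurvePoly

variable {K : Type u} [Field K] (k : ℕ) {F : K[X]} (hF : F = 1 - 4 * X ^ (2 * k + 1))

/-- `d/dX (1 − 4X^{2k+1}) = −4(2k+1)·X^{2k}`. [cite: MochizukiGenEll2010, Thm 2.1 proof p.12] -/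
theorem DeC.derivative_curvePoly :
    derivative (1 - 4 * X ^ (2 * k + 1) : K[X]) = -(C (4 * (2 * k + 1 : K)) * X ^ (2 * k)) := by
  rw [show (4 : K[X]) = C 4 from (map_ofNat C 4).symm, derivative_sub, derivative_one,
    derivative_C_mul, derivative_X_pow, Nat.add_sub_cancel, zero_sub, ← mul_assoc, ← C_mul]
  push_cast
  ring

include hF in
/-- In `K[D_e]`: `s² = 1 − 4r^{2k+1}`. [cite: MochizukiGenEll2010, Thm 2.1 proof p.12] -/
theorem DeC.root_sq :
    AdjoinRoot.root (poly F) ^ 2 = 1 - 4 * algebraMap K[X] (CoordRing F) X ^ (2 * k + 1) := by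
  rw [HyperellipticCoordinateRing.root_sq, congrArg (algebraMap K[X] (CoordRing F)) hF]
  simp only [map_sub, map_one, map_mul, map_pow, map_ofNat]

/-- The tangent derivation on `r`: `D r = 2s`. [cite: MochizukiGenEll2010, Thm 2.1 proof p.12] -/
theorem DeC.tangentDerivation_x (F : K[X]) :
    tangentDerivation F (algebraMap K[X] (CoordRing F) X) = 2 * AdjoinRoot.root (poly F) := by
  rw [tangentDerivation_algebraMap, derivative_X, map_one, mul_one]

include hF in
/-- The tangent derivation on `s`: `D s = −4(2k+1)·r^{2k}`. [cite: MochizukiGenEll2010, Thm 2.1 proof p.12] -/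
theorem DeC.tangentDerivation_y :
    tangentDerivation F (AdjoinRoot.root (poly F)) =
      -(4 * (2 * k + 1) * algebraMap K[X] (CoordRing F) X ^ (2 * k)) := by
  rw [tangentDerivation_root, congrArg derivative hF, DeC.derivative_curvePoly, map_neg, map_mul,
    map_pow, ← Polynomial.algebraMap_eq, ← IsScalarTower.algebraMap_apply K K[X]]
  simp only [map_mul, map_ofNat, map_add, map_one, map_natCast]

include hF in
/-- **`2·N_c = U·D T − T·D U`** in `K[D_e]` for `T = s + c·r^{k+2}`, `U = r·s`,
`N_c = −s³ + c·((k+1)r^{k+2} − 2r^{3k+3})` — i.e. `N_c/(rs)² = ½·D(t_c)`, `t_c = T/U`: the kernel check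
that `N_c` is the ramification function of `t_c` (`N_c = r²s³·dt_c/dr`, `D = 2s·d/dr`).
[cite: MochizukiGenEll2010, Thm 2.1 proof p.12] -/
theorem DeC.two_mul_N_eq (c : K) {x y c' T U N : CoordRing F}
    (hx : x = algebraMap K[X] (CoordRing F) X) (hy : y = AdjoinRoot.root (poly F))
    (hc' : c' = algebraMap K (CoordRing F) c) (hT : T = y + c' * x ^ (k + 2)) (hU : U = x * y)
    (hN : N = -y ^ 3 + c' * ((k + 1) * x ^ (k + 2) - 2 * x ^ (3 * k + 3))) :
    2 * N = U * tangentDerivation F T - T * tangentDerivation F U := by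
  have hsq := DeC.root_sq k hF
  have hDx := DeC.tangentDerivation_x F
  have hDy := DeC.tangentDerivation_y k hF
  have hDc : tangentDerivation F c' = 0 := by rw [hc', Derivation.map_algebraMap]
  rw [← hx, ← hy] at hsq hDx hDy
  rw [hT, hU, hN]
  have e1 : k + 2 - 1 = k + 1 := by omega
  simp only [map_add, Derivation.leibniz, Derivation.leibniz_pow, hDx, hDy, hDc, smul_eq_mul,
    nsmul_eq_mul, mul_zero, add_zero, e1]
  push_cast
  linear_combination (-(2 * c' * ((k : CoordRing F) + 1) * x ^ (k + 2))) * hsq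

include hF in
/-- `(0, 1)` is a point of `D_e`: `1² = (1 − 4X^{2k+1})(0)`. [cite: MochizukiGenEll2010, Thm 2.1 proof p.12] -/
theorem DeC.one_sq_eq_aeval_zero : (1 : K) ^ 2 = aeval (0 : K) F := by
  rw [hF]
  simp

include hF in
/-- `T − β·U = s + c·r^{k+2} − β·rs ≠ 0` in `K[D_e]` (its value at the point `(0, 1)` is `1`).
[cite: MochizukiGenEll2010, Thm 2.1 proof p.12] -/
theorem DeC.T_sub_ne_zero (c β : K) {x y c' T U : CoordRing F}
    (hx : x = algebraMap K[X] (CoordRing F) X) (hy : y = AdjoinRoot.root (poly F))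
    (hc' : c' = algebraMap K (CoordRing F) c) (hT : T = y + c' * x ^ (k + 2)) (hU : U = x * y) :
    T - algebraMap K (CoordRing F) β * U ≠ 0 := by
  rw [hT, hU, hx, hy, hc']
  intro h0
  have h1 := DeC.one_sq_eq_aeval_zero k hF
  have h := congrArg (AdjoinRoot.lift ((aeval (0 : K) : K[X] →ₐ[K] K) : K[X] →+* K) 1
    (eval₂_poly_eq_zero F h1)) h0
  rw [map_zero, map_sub, map_mul, map_mul, map_add, map_mul, map_pow, lift_root_eq F h1,
    lift_algebraMap_eq F h1, lift_algebraMap_base_eq F h1, lift_algebraMap_base_eq F h1, aeval_X,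
    zero_pow (by omega : k + 2 ≠ 0), mul_zero, add_zero, zero_mul, mul_zero, sub_zero] at h
  exact one_ne_zero h

end CurvePoly

section CharZero

variable {K : Type u} [Field K] [CharZero K] (k : ℕ) {F : K[X]} (hF : F = 1 - 4 * X ^ (2 * k + 1))

include hF in
/-- `1 − 4X^{2k+1}` is squarefree (it is separable: `1 = (1 − 4X^e) + (−X/e)·(1 − 4X^e)′`,
characteristic zero). [cite: MochizukiGenEll2010, Thm 2.1 proof p.12] -/
theorem DeC.squarefree_curvePoly : Squarefree F := by
  rw [hF]
  apply Polynomial.Separable.squarefree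
  rw [Polynomial.separable_def, DeC.derivative_curvePoly]
  have he : (2 * k + 1 : K) ≠ 0 := by exact_mod_cast Nat.succ_ne_zero (2 * k)
  have hC : C ((2 * k + 1 : K)⁻¹) * C (4 * (2 * k + 1 : K)) = (C 4 : K[X]) := by
    rw [← C_mul]
    congr 1
    field_simp
  refine ⟨1, -(C ((2 * k + 1 : K)⁻¹) * X), ?_⟩
  rw [show (4 : K[X]) = C 4 from (map_ofNat C 4).symm]
  linear_combination (X ^ (2 * k + 1)) * hC

include hF in
/-- `deg (1 − 4X^{2k+1}) = 2k + 1`. [cite: MochizukiGenEll2010, Thm 2.1 proof p.12] -/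
theorem DeC.natDegree_curvePoly : F.natDegree = 2 * k + 1 := by
  rw [hF, show (4 : K[X]) = C 4 from (map_ofNat C 4).symm, natDegree_sub_eq_right_of_natDegree_lt] <;>
    rw [natDegree_C_mul_X_pow _ _ (by norm_num : (4 : K) ≠ 0)]
  simp

include hF in
/-- `deg (1 − 4X^{2k+1}) > 0`. [cite: MochizukiGenEll2010, Thm 2.1 proof p.12] -/
theorem DeC.natDegree_curvePoly_pos : 0 < F.natDegree := by
  rw [DeC.natDegree_curvePoly k hF]
  omega

include hF in
/-- `N_c ≠ 0` in `K[D_e]` (its value at the point `(0, 1)` is `−1`). [cite: MochizukiGenEll2010, Thm 2.1 proof p.12] -/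
theorem DeC.N_ne_zero (c : K) {x y c' N : CoordRing F}
    (hx : x = algebraMap K[X] (CoordRing F) X) (hy : y = AdjoinRoot.root (poly F))
    (hc' : c' = algebraMap K (CoordRing F) c)
    (hN : N = -y ^ 3 + c' * ((k + 1) * x ^ (k + 2) - 2 * x ^ (3 * k + 3))) : N ≠ 0 := by
  rw [hN, hx, hy, hc']
  intro h0
  have h1 := DeC.one_sq_eq_aeval_zero k hF
  have h := congrArg (AdjoinRoot.lift ((aeval (0 : K) : K[X] →ₐ[K] K) : K[X] →+* K) 1
    (eval₂_poly_eq_zero F h1)) h0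
  rw [map_zero, map_add, map_neg, map_pow, map_mul, map_sub, map_mul, map_mul, map_pow, map_pow,
    lift_root_eq F h1, lift_algebraMap_eq F h1, lift_algebraMap_base_eq F h1, aeval_X,
    zero_pow (by omega : k + 2 ≠ 0), zero_pow (by omega : 3 * k + 3 ≠ 0), mul_zero, mul_zero,
    sub_zero, mul_zero, add_zero, one_pow, neg_eq_zero] at h
  exact one_ne_zero h

/-- **A zero of `N_c` on `D_e` with coordinates `(r, s)` in a field of characteristic zero** (`c ≠ 0`):
`r ≠ 0`, `s ≠ 0`, `r` is a root of `R_c`, and `s + c·r^{k+2} = tCritC(k, c, r)·(r·s)` — i.e. the point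
is a regular point of `t_c` with value `t_c = tCritC k c r` (abc-iut-w5-d059's critical-locus algebra,
read at the point `(x, r) = ((1 − s)/2, r)`). [cite: MochizukiGenEll2010, Thm 2.1 proof p.12] -/
theorem DeC.point_of_N_eq_zero {κ : Type v} [Field κ] [CharZero κ] {cκ : κ} (hc : cκ ≠ 0) {r s : κ}
    (hs : s ^ 2 = 1 - 4 * r ^ (2 * k + 1))
    (hN : -s ^ 3 + cκ * ((k + 1) * r ^ (k + 2) - 2 * r ^ (3 * k + 3)) = 0) :
    r ≠ 0 ∧ s ≠ 0 ∧ (DeCrit.RpolyC k cκ).eval r = 0 ∧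
      s + cκ * r ^ (k + 2) = DeCrit.tCritC k cκ r * (r * s) := by
  have hsx : 1 - 2 * ((1 - s) / 2) = s := by ring
  have hP' : r ^ (2 * k + 1) = (1 - s) / 2 * (1 - (1 - s) / 2) := by
    linear_combination (1 / 4 : κ) * hs
  have hP : (((1 - s) / 2, r) : κ × κ).2 ^ (2 * k + 1) =
      (((1 - s) / 2, r) : κ × κ).1 * (1 - (((1 - s) / 2, r) : κ × κ).1) := hP'
  have hNP : DeCrit.NvalC k cκ ((1 - s) / 2, r) = 0 := by
    rw [DeCrit.NvalC_eq, hsx]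
    exact hN
  obtain ⟨hr0, hs0⟩ := DeCrit.snd_ne_zero_and_one_sub_two_mul_ne_zero_of_NvalC hc hP hNP
  have ht := DeCrit.tC_eq_tCritC hc hP hNP
  dsimp only at hr0 hs0 ht
  rw [hsx] at hs0
  rw [DeCrit.tC, hsx, div_eq_iff (mul_ne_zero hr0 hs0)] at ht
  exact ⟨hr0, hs0, DeCrit.eval_RpolyC_eq_zero_of_NvalC_eq_zero k cκ hP' hNP, ht⟩

include hF in
/-- **The zeros of `N_c` are regular points of `t_c` with values in `A`.**  For a maximal ideal `𝔪` of
`K[D_e]` containing `N_c` (a closed point `Q` with `N_c(Q) = 0`, coordinates in the residue field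
`κ = K[D_e]/𝔪`): `U = rs ∉ 𝔪`, the `r`-coordinate is a root of `R_c`, hence — `R_c` being split in `K` —
the image of a root `θ ∈ K`, and `t_c(Q) = tCritC k c θ =: β ∈ A`, i.e. `T − β·U ∈ 𝔪`.
[cite: MochizukiGenEll2010, Thm 2.1 proof p.12] -/
theorem DeC.maximal_of_N_mem {c : K} (hc : c ≠ 0) (A : Finset K)
    (hsplit : (DeCrit.RpolyC k c).Splits)
    (hA : ∀ θ : K, (DeCrit.RpolyC k c).eval θ = 0 → DeCrit.tCritC k c θ ∈ A)
    {x y c' T U N : CoordRing F}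
    (hx : x = algebraMap K[X] (CoordRing F) X) (hy : y = AdjoinRoot.root (poly F))
    (hc' : c' = algebraMap K (CoordRing F) c) (hT : T = y + c' * x ^ (k + 2)) (hU : U = x * y)
    (hN : N = -y ^ 3 + c' * ((k + 1) * x ^ (k + 2) - 2 * x ^ (3 * k + 3)))
    (m : Ideal (CoordRing F)) (hm : m.IsMaximal) (hNm : N ∈ m) :
    U ∉ m ∧ ∃ β ∈ A, T - algebraMap K (CoordRing F) β * U ∈ m := by
  have hsq := DeC.root_sq k hF
  rw [← hx, ← hy] at hsq
  letI := Ideal.Quotient.field m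
  haveI : CharZero (CoordRing F ⧸ m) :=
    charZero_of_injective_algebraMap (algebraMap K (CoordRing F ⧸ m)).injective
  have hcκ : algebraMap K (CoordRing F ⧸ m) c ≠ 0 := (_root_.map_ne_zero _).mpr hc
  have hπc : Ideal.Quotient.mk m c' = algebraMap K (CoordRing F ⧸ m) c := by
    rw [hc']
    rfl
  -- the coordinates `(r, s) = (x̄, ȳ)` of the closed point satisfy the curve equation and `N_c = 0`
  have hs : (Ideal.Quotient.mk m y) ^ 2 = 1 - 4 * (Ideal.Quotient.mk m x) ^ (2 * k + 1) := by
    have h := congrArg (Ideal.Quotient.mk m) hsq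
    rwa [map_pow, map_sub, map_one, map_mul, map_ofNat, map_pow] at h
  have hNκ : -(Ideal.Quotient.mk m y) ^ 3 + algebraMap K (CoordRing F ⧸ m) c *
      ((k + 1) * (Ideal.Quotient.mk m x) ^ (k + 2) - 2 * (Ideal.Quotient.mk m x) ^ (3 * k + 3)) = 0 := by
    have h := Ideal.Quotient.eq_zero_iff_mem.mpr hNm
    rwa [hN, map_add, map_neg, map_pow, map_mul, hπc, map_sub, map_mul, map_mul, map_pow, map_pow,
      map_add, map_one, map_natCast, map_ofNat] at h
  obtain ⟨hr0, hs0, hR, hTU⟩ := DeC.point_of_N_eq_zero k hcκ hs hNκ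
  refine ⟨fun hUm => ?_, ?_⟩
  · have h := Ideal.Quotient.eq_zero_iff_mem.mpr hUm
    rw [hU, map_mul] at h
    exact mul_ne_zero hr0 hs0 h
  -- the `r`-coordinate is a root of `R_c`, hence the image of a root `θ ∈ K`
  have hmem : Ideal.Quotient.mk m x ∈ ((DeCrit.RpolyC k c).map (algebraMap K (CoordRing F ⧸ m))).roots := by
    rw [mem_roots (Polynomial.map_ne_zero (DeCrit.RpolyC_ne_zero k c)), IsRoot.def,
      DeCrit.map_RpolyC]
    exact hR
  rw [hsplit.roots_map (algebraMap K _), Multiset.mem_map] at hmem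
  obtain ⟨θ, hθ, hθr⟩ := hmem
  have hθ0 : (DeCrit.RpolyC k c).eval θ = 0 := (mem_roots (DeCrit.RpolyC_ne_zero k c)).mp hθ
  refine ⟨DeCrit.tCritC k c θ, hA θ hθ0, ?_⟩
  rw [← Ideal.Quotient.eq_zero_iff_mem, map_sub, map_mul, Ideal.Quotient.mk_algebraMap,
    DeCrit.map_tCritC (algebraMap K (CoordRing F ⧸ m)), hθr, hT, hU, map_add, map_mul, map_mul,
    map_pow, hπc, hTU, sub_self]

include hF in
/-- **`N_c ∣ ∏_{β∈A} (s + c·r^{k+2} − β·rs)` in the coordinate ring `K[D_e]`**, for `c ≠ 0`, `R_c` split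
in `K`, and `A ∋` every critical value `tCritC k c θ`: Mason's order drop at each zero of `N_c`
(`HyperellipticCoordinateRing.dvd_prod_of_tangentDerivation`) with the inputs `DeC.two_mul_N_eq`,
`DeC.N_ne_zero`, `DeC.maximal_of_N_mem`, `DeC.T_sub_ne_zero`.
[cite: MochizukiGenEll2010, Thm 2.1 proof p.12] -/
theorem DeC.N_dvd_prod {c : K} (hc : c ≠ 0) (A : Finset K) (hsplit : (DeCrit.RpolyC k c).Splits)
    (hA : ∀ θ : K, (DeCrit.RpolyC k c).eval θ = 0 → DeCrit.tCritC k c θ ∈ A)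
    {x y c' T U N : CoordRing F}
    (hx : x = algebraMap K[X] (CoordRing F) X) (hy : y = AdjoinRoot.root (poly F))
    (hc' : c' = algebraMap K (CoordRing F) c) (hT : T = y + c' * x ^ (k + 2)) (hU : U = x * y)
    (hN : N = -y ^ 3 + c' * ((k + 1) * x ^ (k + 2) - 2 * x ^ (3 * k + 3))) :
    N ∣ ∏ β ∈ A, (T - algebraMap K (CoordRing F) β * U) :=
  dvd_prod_of_tangentDerivation (DeC.squarefree_curvePoly k hF) (DeC.natDegree_curvePoly_pos k hF) A
    (DeC.two_mul_N_eq k hF c hx hy hc' hT hU hN) (DeC.N_ne_zero k hF c hx hy hc' hN)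
    (DeC.maximal_of_N_mem k hF hc A hsplit hA hx hy hc' hT hU hN)
    (fun β _ => DeC.T_sub_ne_zero k hF c β hx hy hc' hT hU)

/-- **The identity at every point.**  For `c ≠ 0`, `R_c` split in `K` and `A ⊂ K` finite containing every
critical value `tCritC k c θ` (`θ` the roots of `R_c`), there are `H₀, H₁ ∈ K[X]` such that for every
commutative `K`-algebra `L` and all `r, s ∈ L` on `D_e` (`s² = 1 − 4r^{2k+1}`):
`∏_{β∈A} (s + c·r^{k+2} − β·(rs)) = (−s³ + c·((k+1)r^{k+2} − 2r^{3k+3}))·(H₀(r) + H₁(r)·s)` — the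
ramification function `N_c` divides the product of the fibre functions `rs·(t_c − β)` over the critical
values, with an explicit polynomial cofactor. [cite: MochizukiGenEll2010, Thm 2.1 proof p.12] -/
theorem DeC.exists_prod_fibre_eq_N_mul {c : K} (hc : c ≠ 0) (A : Finset K)
    (hsplit : (DeCrit.RpolyC k c).Splits)
    (hA : ∀ θ : K, (DeCrit.RpolyC k c).eval θ = 0 → DeCrit.tCritC k c θ ∈ A) :
    ∃ H₀ H₁ : K[X], ∀ (L : Type v) [CommRing L] [Algebra K L] (r s : L),
      s ^ 2 = 1 - 4 * r ^ (2 * k + 1) →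
        ∏ β ∈ A, (s + algebraMap K L c * r ^ (k + 2) - algebraMap K L β * (r * s)) =
          (-s ^ 3 + algebraMap K L c * ((k + 1) * r ^ (k + 2) - 2 * r ^ (3 * k + 3))) *
            (aeval r H₀ + aeval r H₁ * s) := by
  have hF : (1 - 4 * X ^ (2 * k + 1) : K[X]) = 1 - 4 * X ^ (2 * k + 1) := rfl
  obtain ⟨H, hH⟩ := DeC.N_dvd_prod k hF hc A hsplit hA
    (x := algebraMap K[X] (CoordRing (1 - 4 * X ^ (2 * k + 1) : K[X])) X)
    (y := AdjoinRoot.root (poly (1 - 4 * X ^ (2 * k + 1) : K[X])))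
    (c' := algebraMap K (CoordRing (1 - 4 * X ^ (2 * k + 1) : K[X])) c) rfl rfl rfl rfl rfl rfl
  obtain ⟨H₀, H₁, rfl⟩ := exists_eq_add_mul_y (1 - 4 * X ^ (2 * k + 1) : K[X]) H
  refine ⟨H₀, H₁, fun L _ _ r s hs => ?_⟩
  have hs' : s ^ 2 = aeval r (1 - 4 * X ^ (2 * k + 1) : K[X]) := by
    rw [hs]
    simp only [map_sub, map_one, map_mul, map_ofNat, map_pow, aeval_X]
  have h := congrArg (AdjoinRoot.lift ((aeval r : K[X] →ₐ[K] L) : K[X] →+* L) s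
    (eval₂_poly_eq_zero _ hs')) hH
  simp only [map_prod, map_sub, map_add, map_mul, map_neg, map_pow, map_natCast, map_one, map_ofNat,
    lift_root_eq _ hs', lift_algebraMap_eq _ hs', lift_algebraMap_base_eq _ hs', aeval_X] at h
  rw [h]

/-- **The identity at every point, in the consumer's literal shape** (abc-iut-w5-d090's (F-b)
hypothesis `hH`): with `N` bound by its normal form and the cofactor written through
`H₀.map (algebraMap K L)`, `H₁.map (algebraMap K L)`. [cite: MochizukiGenEll2010, Thm 2.1 proof p.12] -/
theorem DeC.exists_prod_fibre_eq_N_mul' {c : K} (hc : c ≠ 0) (A : Finset K)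
    (hsplit : (DeCrit.RpolyC k c).Splits)
    (hA : ∀ θ : K, (DeCrit.RpolyC k c).eval θ = 0 → DeCrit.tCritC k c θ ∈ A) :
    ∃ H₀ H₁ : K[X], ∀ (L : Type v) [CommRing L] [Algebra K L] (r s N : L),
      s ^ 2 = 1 - 4 * r ^ (2 * k + 1) →
        N = -s ^ 3 + algebraMap K L c * ((k + 1) * r ^ (k + 2) - 2 * r ^ (3 * k + 3)) →
          ∏ β ∈ A, (s + algebraMap K L c * r ^ (k + 2) - algebraMap K L β * (r * s)) =
            N * (aeval r (H₀.map (algebraMap K L)) + s * aeval r (H₁.map (algebraMap K L))) := by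
  obtain ⟨H₀, H₁, h⟩ := DeC.exists_prod_fibre_eq_N_mul (K := K) k hc A hsplit hA
  refine ⟨H₀, H₁, fun L _ _ r s N hs hN => ?_⟩
  rw [h L r s hs, hN, aeval_map_algebraMap, aeval_map_algebraMap, mul_comm s]

end CharZero

end Literature.NumberTheory.DiophantineGeometry.GenEll
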